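import Summits.AtomisticToContinuum.BoseEinsteinCondensation.Theorems.BECThomsonPrinciplePeriodicToDirichletDefs
import Literature.MathematicalPhysics.QuantumManyBody.BoseGasCutoffStateOccupation

/-!
# Route `BECThomsonPrinciple`, crux `PeriodicToDirichlet` (stmt-AtomisticToContinuum-9483),
# line `reward-pays-the-wall` — stub `stub_cutoffOccupation`

The registered stub `stub_cutoffOccupation : CutoffOccupation` of the skeleton
`Lines/reward-pays-the-wall.lean` (statement in
`Theorems/BECThomsonPrinciplePeriodicToDirichletDefs.lean`): the constant-mode occupation of a
periodic trial state is controlled by the flat-mode (`boxConstantMode`) occupation of its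
Basti–Cenatiempo–Schlein cut-off `Φ₀(X) = Ψ(X + 0) ∏_{i,k} q(x_{ik})` in the box `Λ_{L+2ℓ}`,
`n₀(Ψ) ≤ ((L+2ℓ)/L)³ n_φ(Φ₀) + C N √(ℓ/L)`, universal `C`. It is literally the generic Literature
theorem `exists_condensateOccupation_le_occupation_cutoffState` of
`Literature/MathematicalPhysics/QuantumManyBody/BoseGasCutoffStateOccupation.lean` (`C = 320`;
mechanism: unfold the other particles against the partition of unity `∑_z Q(· - Lz)² = 1`, compare
`∫_{cell} Ψ(·,Y)` with `∫ Ψ(·,Y) Q` on the boundary layer `[0,L+2ℓ)³ ∖ [2ℓ,L)³` of volume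
`≤ 16 L² ℓ`, Young with parameter `√(ℓ/L)` and Cauchy–Schwarz in `x`; no positivity of `Ψ`).

References: Basti–Cenatiempo–Schlein 2021 (arXiv:2101.06222), App. A, Lemma A.1 (the cut-off and
the transport of one-body observables); Fournais 2020, (1.3)–(1.5) (`n₀`).
-/

noncomputable section

namespace Summit.AtomisticToContinuum.BoseEinsteinCondensation.RewardPaysTheWall

open Literature.MathematicalPhysics.QuantumManyBody.BoseGas

/-- **Stub `stub_cutoffOccupation` of the skeleton of line `reward-pays-the-wall`**: the flat-mode
occupation of the Basti–Cenatiempo–Schlein cut-off state controls the torus condensate,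
`n₀(Ψ) ≤ ((L+2ℓ)/L)³ n_φ(Φ₀) + C N √(ℓ/L)` with a universal `C` (`C = 320`), for every continuous
cut-off profile with values in `[0,1]`, support in `(0, L+2ℓ)` and `∑_m q(t - Lm)² = 1`, and every
periodic trial state — literally the generic Literature theorem
`exists_condensateOccupation_le_occupation_cutoffState` (`BoseGasCutoffStateOccupation.lean`:
unfold the other particles against `∑ Q² = 1`, compare `∫_{cell} Ψ` with `∫ Ψ Q` on the boundary
layer `[0,L+2ℓ)³ ∖ [2ℓ,L)³` of volume `≤ 16 L² ℓ`, Young and Cauchy–Schwarz; no positivity of `Ψ`).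
Basti–Cenatiempo–Schlein 2021, App. A, Lemma A.1. [folklore] -/
theorem stub_cutoffOccupation : CutoffOccupation :=
  exists_condensateOccupation_le_occupation_cutoffState

end Summit.AtomisticToContinuum.BoseEinsteinCondensation.RewardPaysTheWall

end
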